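import Summits.Ventures.PercRepro.C025ProfileStagedLine3Thm
import Summits.Ventures.PercRepro.C025ProfileCertBridge

/-!
# THE ROW `(q, q+1)` OF THE PROFILE INEQUALITY IN THE THIN REGIME — part A: the price, the thin facts, (Dem) (night-3 g13)
`proofs/NIGHT3-G13-LIFT.md`. The row `(q, q+1)` of `(Π)` (C-032) reads `(q+1)·#{S : ρ(S) = q+1} ≥ Σ_{B : ρ(B) = q, ρ(E∖B) ≥ q+1} ρ(E∖B)`.
THE THIN REGIME: every rank-`q` subset of the ground set has at most `q + 1` points (`hthin`). There a rank-`q` set `B` has at most one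
inner point (`card_inner_le_one`), so `ρ(E∖B) ≤ |F_B| + 1` (`crk_le_card_outer_add_one`, `F_B = E ∖ cl B`), and the SIMPLE RULE
* `W(B, B ∪ {x}) = 1` for every `x ∈ F_B` (the `e = 1` sets), and
* `W(B, cl B ∪ {x}) = 1/|F_B|` for every `x ∈ F_B` when `B` is SHORT (`ρ(E∖B) = |F_B| + 1`),
in the capacity-`1` normalisation (divided by `q + 1`) pays every rank-`q` set its price `ρ(E∖B)/(q+1)` (`dem_thin`) — with no
hypothesis beyond thinness. Part B (`C025ProfileThinRowB`) proves (Cap) for `q ≤ 5` on simple matroids and assembles the row.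
The rule is the `e = 1` / `Ls` skeleton of the row-`(3,4)` staged certificate (C025ProfileStagedRule) with the multipliers
`rb = 1`, `jsh = 1/|F_B|` and no allowance; its lift beyond the thin regime, and the thin regime beyond `q = 5`, FAIL (the paper, §3).
-/
open scoped Matroid
namespace PercRepro
open Set Finset ThmH Staged
namespace ThinRow
variable {α : Type} [DecidableEq α] {M : Matroid α} [M.Finite]

/-- `C(p+q, q+1)/C(p+q, q) = p/(q+1)`. -/
theorem choose_ratio_succ (p q : ℕ) :
    (Nat.choose (p + q) (q + 1) : ℚ) / (Nat.choose (p + q) q : ℚ) = (p : ℚ) / ((q : ℚ) + 1) := by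
  have h := Nat.choose_succ_right_eq (p + q) q
  rw [show p + q - q = p by omega] at h
  have hpos : (0 : ℚ) < Nat.choose (p + q) q := by exact_mod_cast Nat.choose_pos (by omega)
  have hq : (0 : ℚ) < (q : ℚ) + 1 := by positivity
  rw [div_eq_div_iff hpos.ne' hq.ne']
  have h' : ((Nat.choose (p + q) (q + 1) * (q + 1) : ℕ) : ℚ) = ((Nat.choose (p + q) q * p : ℕ) : ℚ) := by rw [h]
  push_cast at h'
  linarith

/-- The price at `(q, q+1)` is `[q+1 ≤ ρ(E∖B)] · ρ(E∖B)/(q+1)`. -/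
theorem price_succ_eq (q : ℕ) (B : Finset α) :
    Profile.price M q (q + 1) B = if q + 1 ≤ crk M B then (crk M B : ℚ) / ((q : ℚ) + 1) else 0 := by
  have hfin : M.eRk ((gr M \ B : Finset α) : Set α) ≠ ⊤ := eRk_ne_top _
  unfold Profile.price crk
  rw [← ENat.coe_toNat hfin, ENat.toNat_coe]
  by_cases h : q + 1 ≤ (M.eRk ((gr M \ B : Finset α) : Set α)).toNat
  · rw [if_pos (by exact_mod_cast h), if_pos h, choose_ratio_succ]
  · rw [if_neg (by exact_mod_cast h), if_neg h]

/-- In the thin regime a rank-`q` set `B ⊆ gr M` has at most one inner point. -/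
theorem card_inner_le_one {q : ℕ} (hthin : ∀ X ⊆ gr M, rkN M X = q → X.card ≤ q + 1) {B : Finset α}
    (hBg : B ⊆ gr M) (hB : rkN M B = q) : (inner M B).card ≤ 1 := by
  have h1 : (clF M B).card ≤ q + 1 := hthin _ (clF_subset_gr B) (by rw [rkN_clF, hB])
  have h2 : q ≤ B.card := hB ▸ rkN_le_card B
  have h3 : (inner M B).card = (clF M B).card - B.card := Finset.card_sdiff_of_subset (subset_clF_self hBg)
  omega

/-- In the thin regime `ρ(E∖B) ≤ |F_B| + 1`. -/
theorem crk_le_card_outer_add_one {q : ℕ} (hthin : ∀ X ⊆ gr M, rkN M X = q → X.card ≤ q + 1) {B : Finset α}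
    (hBg : B ⊆ gr M) (hB : rkN M B = q) : crk M B ≤ (outer M B).card + 1 := by
  have h1 := crk_le_fB_add_card_inner hBg
  have h2 : fB M B ≤ (outer M B).card := rkN_le_card _
  have h3 := card_inner_le_one hthin hBg hB
  omega

/-- In the thin regime the closure of a rank-`q` set `B ⊆ gr M` has at most `|B| + 1` points. -/
theorem card_clF_le_add_one {q : ℕ} (hthin : ∀ X ⊆ gr M, rkN M X = q → X.card ≤ q + 1) {B : Finset α}
    (hBg : B ⊆ gr M) (hB : rkN M B = q) : (clF M B).card ≤ B.card + 1 := by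
  have h3 : (inner M B).card = (clF M B).card - B.card := Finset.card_sdiff_of_subset (subset_clF_self hBg)
  have h4 := card_inner_le_one hthin hBg hB
  have h5 : B.card ≤ (clF M B).card := Finset.card_le_card (subset_clF_self hBg)
  omega

/-- A one-point extension `B ∪ {x}`, `x ∈ F_B`, of a rank-`q` set `B ⊆ gr M` lies in the level `q + 1`. -/
theorem insert_mem_levelSet_succ {q : ℕ} {B : Finset α} (hBg : B ⊆ gr M) (hB : rkN M B = q) {x : α}
    (hx : x ∈ outer M B) : insert x B ∈ Shadow.levelSet M (q + 1) := by
  rw [Profile.mem_levelSet]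
  refine ⟨Finset.insert_subset (mem_outer.mp hx).1 hBg, ?_⟩
  rw [← rkN_eq_iff, rkN_insert_of_mem_outer hx, hB]

/-- The set `cl B ∪ {x}`, `x ∈ F_B`, of a rank-`q` set `B ⊆ gr M` lies in the level `q + 1`. -/
theorem insert_clF_mem_levelSet_succ {q : ℕ} {B : Finset α} (hB : rkN M B = q) {x : α}
    (hx : x ∈ outer M B) : insert x (clF M B) ∈ Shadow.levelSet M (q + 1) := by
  rw [Profile.mem_levelSet]
  refine ⟨Finset.insert_subset (mem_outer.mp hx).1 (clF_subset_gr B), ?_⟩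
  rw [← rkN_eq_iff, rkN_insert_clF, rkN_insert_of_mem_outer hx, hB]

/-- `x ↦ B ∪ {x}` is injective on `F_B` (`B ⊆ gr M`). -/
theorem injOn_insert (B : Finset α) (hBg : B ⊆ gr M) : Set.InjOn (fun x => insert x B) (outer M B : Set α) := by
  intro x hx x' hx' hEq
  have hEq' : insert x B = insert x' B := hEq
  have hxB : x ∉ B := notMem_of_mem_outer hBg hx
  have : x ∈ insert x' B := hEq' ▸ Finset.mem_insert_self x B
  rw [Finset.mem_insert] at this
  rcases this with h | h
  · exact h
  · exact absurd h hxB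

/-- `x ↦ cl B ∪ {x}` is injective on `F_B`. -/
theorem injOn_insert_clF (B : Finset α) : Set.InjOn (fun x => insert x (clF M B)) (outer M B : Set α) := by
  intro x hx x' hx' hEq
  have hEq' : insert x (clF M B) = insert x' (clF M B) := hEq
  have hxB : x ∉ clF M B := (mem_outer.mp hx).2
  have : x ∈ insert x' (clF M B) := hEq' ▸ Finset.mem_insert_self x _
  rw [Finset.mem_insert] at this
  rcases this with h | h
  · exact h
  · exact absurd h hxB

/-- The `e = 1` sets of `B` are pairwise distinct: `Σ_{x ∈ F_B} [∃ x' ∈ F_B, B ∪ {x} = B ∪ {x'}] = |F_B|` — stated as the sum of the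
first indicator over the image. -/
theorem sum_w1_image {q : ℕ} (B : Finset α) (hBg : B ⊆ gr M) (hd : q + 1 ≤ crk M B) :
    ∑ S ∈ (outer M B).image (fun x => insert x B),
      (if q + 1 ≤ crk M B ∧ ∃ x ∈ outer M B, S = insert x B then (1 : ℚ) else 0) = ((outer M B).card : ℚ) := by
  rw [Finset.sum_image (injOn_insert B hBg)]
  have h : ∀ x ∈ outer M B, (if q + 1 ≤ crk M B ∧ ∃ x' ∈ outer M B, insert x B = insert x' B then (1 : ℚ) else 0) = 1 := by
    intro x hx
    rw [if_pos ⟨hd, x, hx, rfl⟩]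
  rw [Finset.sum_congr rfl h, Finset.sum_const, nsmul_eq_mul, mul_one]

/-- The short sets of `B` pay `1` in total: `Σ_{x ∈ F_B} 1/|F_B| = 1`. -/
theorem sum_w2_image {q : ℕ} (B : Finset α) (hd : q + 1 ≤ crk M B) (hne : (outer M B).Nonempty)
    (hshort : crk M B = (outer M B).card + 1) :
    ∑ S ∈ (outer M B).image (fun x => insert x (clF M B)),
      (if q + 1 ≤ crk M B ∧ crk M B = (outer M B).card + 1 ∧ ∃ x ∈ outer M B, S = insert x (clF M B) then
        1 / ((outer M B).card : ℚ) else 0) = 1 := by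
  rw [Finset.sum_image (injOn_insert_clF B)]
  have h : ∀ x ∈ outer M B, (if q + 1 ≤ crk M B ∧ crk M B = (outer M B).card + 1 ∧
      ∃ x' ∈ outer M B, insert x (clF M B) = insert x' (clF M B) then 1 / ((outer M B).card : ℚ) else 0) =
      1 / ((outer M B).card : ℚ) := by
    intro x hx
    rw [if_pos ⟨hd, hshort, x, hx, rfl⟩]
  rw [Finset.sum_congr rfl h, Finset.sum_const, nsmul_eq_mul]
  have hpos : (0 : ℚ) < (outer M B).card := by exact_mod_cast Finset.card_pos.mpr hne
  field_simp

/-- A demanding `B` (rank `q`, `ρ(E∖B) ≥ q+1`) has a nonempty `F_B`. -/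
theorem outer_nonempty_succ {q : ℕ} {B : Finset α} (hB : rkN M B = q) (hd : q + 1 ≤ crk M B) :
    (outer M B).Nonempty := by
  rw [Finset.nonempty_iff_ne_empty]
  intro hE
  unfold outer at hE
  have hsub : gr M \ B ⊆ clF M B := by
    intro x hx
    by_contra hxc
    have : x ∈ gr M \ clF M B := Finset.mem_sdiff.mpr ⟨(Finset.mem_sdiff.mp hx).1, hxc⟩
    rw [hE] at this
    exact Finset.notMem_empty _ this
  have h1 : crk M B ≤ rkN M (clF M B) := rkN_mono hsub
  rw [rkN_clF, hB] at h1
  omega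

/-- **(Dem) in the thin regime**: every rank-`q` set receives at least its price `ρ(E∖B)/(q+1)` from the simple rule. -/
theorem dem_thin (q : ℕ) (hthin : ∀ X ⊆ gr M, rkN M X = q → X.card ≤ q + 1) {B : Finset α}
    (hB : B ∈ Profile.Rq M q) :
    Profile.price M q (q + 1) B ≤ ∑ S ∈ (Shadow.levelSet M (q + 1)).filter (fun S => B ⊆ S),
      ((if q + 1 ≤ crk M B ∧ ∃ x ∈ outer M B, S = insert x B then (1 : ℚ) else 0) +
        (if q + 1 ≤ crk M B ∧ crk M B = (outer M B).card + 1 ∧ ∃ x ∈ outer M B, S = insert x (clF M B) then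
          1 / ((outer M B).card : ℚ) else 0)) / ((q : ℚ) + 1) := by
  rw [price_succ_eq]
  have hw1 : ∀ S, (0 : ℚ) ≤ (if q + 1 ≤ crk M B ∧ ∃ x ∈ outer M B, S = insert x B then (1 : ℚ) else 0) := by
    intro S; split_ifs <;> norm_num
  have hw2 : ∀ S, (0 : ℚ) ≤ (if q + 1 ≤ crk M B ∧ crk M B = (outer M B).card + 1 ∧ ∃ x ∈ outer M B, S = insert x (clF M B) then
      1 / ((outer M B).card : ℚ) else 0) := by
    intro S; split_ifs <;> positivity
  split_ifs with hd
  swap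
  · exact Finset.sum_nonneg (fun S _ => div_nonneg (add_nonneg (hw1 S) (hw2 S)) (by positivity))
  rw [Profile.mem_Rq] at hB
  have hBg : B ⊆ gr M := hB.1
  have hBq : rkN M B = q := rkN_eq_iff.mpr hB.2
  rw [← Finset.sum_div]
  apply div_le_div_of_nonneg_right _ (by positivity)
  set rng := (Shadow.levelSet M (q + 1)).filter (fun S => B ⊆ S) with hrng
  set img1 := (outer M B).image (fun x => insert x B) with himg1
  set img2 := (outer M B).image (fun x => insert x (clF M B)) with himg2
  have hsub1 : img1 ⊆ rng := by
    intro S hS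
    rw [himg1, Finset.mem_image] at hS
    obtain ⟨x, hx, rfl⟩ := hS
    rw [hrng, Finset.mem_filter]
    exact ⟨insert_mem_levelSet_succ hBg hBq hx, Finset.subset_insert _ _⟩
  have hsub2 : img2 ⊆ rng := by
    intro S hS
    rw [himg2, Finset.mem_image] at hS
    obtain ⟨x, hx, rfl⟩ := hS
    rw [hrng, Finset.mem_filter]
    exact ⟨insert_clF_mem_levelSet_succ hBq hx, (subset_clF_self hBg).trans (Finset.subset_insert _ _)⟩
  rw [Finset.sum_add_distrib]
  have h1 : ∑ S ∈ img1, (if q + 1 ≤ crk M B ∧ ∃ x ∈ outer M B, S = insert x B then (1 : ℚ) else 0) ≤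
      ∑ S ∈ rng, (if q + 1 ≤ crk M B ∧ ∃ x ∈ outer M B, S = insert x B then (1 : ℚ) else 0) :=
    Finset.sum_le_sum_of_subset_of_nonneg hsub1 (fun S _ _ => hw1 S)
  have h2 : ∑ S ∈ img2, (if q + 1 ≤ crk M B ∧ crk M B = (outer M B).card + 1 ∧ ∃ x ∈ outer M B, S = insert x (clF M B) then
      1 / ((outer M B).card : ℚ) else 0) ≤
      ∑ S ∈ rng, (if q + 1 ≤ crk M B ∧ crk M B = (outer M B).card + 1 ∧ ∃ x ∈ outer M B, S = insert x (clF M B) then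
      1 / ((outer M B).card : ℚ) else 0) :=
    Finset.sum_le_sum_of_subset_of_nonneg hsub2 (fun S _ _ => hw2 S)
  rw [himg1, sum_w1_image B hBg hd] at h1
  have hle := crk_le_card_outer_add_one hthin hBg hBq
  rcases Nat.lt_or_ge (crk M B) ((outer M B).card + 1) with hlt | hge
  · have h3 : (0 : ℚ) ≤ ∑ S ∈ rng, (if q + 1 ≤ crk M B ∧ crk M B = (outer M B).card + 1 ∧
        ∃ x ∈ outer M B, S = insert x (clF M B) then 1 / ((outer M B).card : ℚ) else 0) :=
      Finset.sum_nonneg (fun S _ => hw2 S)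
    have h4 : (crk M B : ℚ) ≤ (outer M B).card := by exact_mod_cast Nat.lt_succ_iff.mp hlt
    linarith
  · have hshort : crk M B = (outer M B).card + 1 := le_antisymm hle hge
    rw [himg2, sum_w2_image B hd (outer_nonempty_succ hBq hd) hshort] at h2
    have h4 : (crk M B : ℚ) = (outer M B).card + 1 := by exact_mod_cast hshort
    linarith

end ThinRow
end PercRepro
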